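import Mathlib.NumberTheory.Harmonic.EulerMascheroni
import Mathlib.Data.Nat.Totient
import Literature.Barriers.Parity.SiegelZeroDichotomy
import Literature.NumberTheory.LFunctions.LandauPageRealZeros
import Literature.NumberTheory.LFunctions.ZetaRealAxis
import HarnessLib

/-!
# The first moment of primes in arithmetic progressions under an exceptional character: the
# Fiorilli bias is annihilated and replaced (Drappeau–Fiorilli 2021, Theorem 1.3)

Statement layer for the «illusory world» column (conditional consequences of exceptional zeros),
NEW topic (theory's ruling 2026-08-26T13:05Z): «exceptional character ⇒ the first-moment bias of
primes in arithmetic progressions is annihilated/replaced». Source: S. Drappeau, D. Fiorilli, *The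
first moment of primes in arithmetic progressions: beyond the Siegel–Walfisz range*, Trans. London
Math. Soc. 8 (2021) 174–185 [DrappeauFiorilli2021]; held copy = arXiv:2003.02201 (tex), §1: (1.1)–(1.8),
Theorems 1.1–1.3 and the paragraph after Theorem 1.3; §2.3 Lemma 2.4 (the constants `C_{a,q₀}`,
`D_{a,q₀}`).

## What the source prints (§1)

`ψ(x; q, a) = ∑_{n ≤ x, n ≡ a (q)} Λ(n)`; `ψ*(x; q, a) = ∑_{1 ≤ n ≤ x, n ≡ a (q), n ≠ a} Λ(n)`;
`M₁(x, N; a) = ∑_{q ≤ x/N, (q,a)=1} (ψ*(x; q, a) − x/φ(q))`; [Fiorilli 2012] for `N ≤ (log x)^{O(1)}`: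
`M₁(x,N;a)/((φ(|a|)/|a|)(x/N)) = μ(a,N) + O_{a,ε,B}(N^{−171/448+ε})` with (1.3)
`μ(a,N) = −½ log N − C₀` if `a = ±1`, `−½ log p` if `a = ±p^e`, `0` otherwise,
`C₀ = ½(log 2π + γ + ∑_p log p/(p(p−1)) + 1)`.
**Theorem 1.2** (Page, [IK]): "There is an absolute constant `b > 0` such that for all `Q, T ≥ 2` …
`s ↦ ∏_{q ≤ Q} ∏_{χ mod q} L(s, χ)` has at most one zero `s = β` satisfying `Re(s) > 1 − b/log(QT)` and
`Im(s) ≤ T`. If it exists, the zero `β` is real and it is the zero of a unique function `L(s, χ̃)` for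
some primitive real character `χ̃`." "Given `x ≥ 2`, we will say that the character `χ̃ mod q̃` is
`x`-exceptional if the above conditions are met with `Q = T = e^{√log x}`. There is at most one such
character." (1.6): `η_{x,a} := χ̃(a)/(β x^{1−β}) ∈ (−1, 1)`; (1.4)–(1.5): `ψ(x; q, a) =
(x/φ(q))(1 − η_{x,a} 1_{q̃∣q}) + O(x e^{−c√log x})`. (1.7):
`M₁^Z(x, N; a) = ∑_{q ≤ x/N, (q,a)=1} (ψ*(x; q, a) − (1 − 1_{q̃∣q} η_{x,a}) x/φ(q))`, "where, by
convention, the term involving `η_{x,a}` is only to be taken into account when the `x`-exceptional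
character exists."
**Theorem 1.3.** "Fix an integer `a ∈ ℤ∖{0}` and a small enough positive absolute constant `δ`, and let
`x ≥ 2` and `2 ≤ N ≤ e^{δ√log x}`.
* If there is no `x`-exceptional character, then (1.9)
  `M₁(x,N;a)/((φ(|a|)/|a|)(x/N)) = μ(a,N) + O_{a,ε}(N^{−171/448+ε})`.
* If the `x`-exceptional character `χ̃ mod q̃` exists, then with `C_{a,q̃}` and `D_{a,q̃}` as in (2.?)
  below, (1.10) `M₁^Z(x,N;a)/((φ(|a|)/|a|)(x/N)) = μ(a,N) + N η_{x,a} (∑_{r ≤ N, (r,a)=1, q̃∣r}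
  (1 − (r/N)^β)/φ(r) − C_{a,q̃}{log(N/q̃) + D_{a,q̃} − 1/β}) + O_{a,ε}(N^{−171/448+ε})`.
* If the `x`-exceptional character exists and `N ≥ q̃`, then the previous formula admits the
  approximation (1.11) `M₁^Z(x,N;a)/((φ(|a|)/|a|)(x/N)) = (1 − η_{x,a}) μ(a,N) + η_{x,a} μ̃_χ̃(a)
  + O_{a,ε}(N^ε (N/q̃)^{−171/448} + (log N)²(1−β)/x^{(1−β)/2})`, where
  `μ̃_χ̃(a) = ½ 1_{a=±1}(log q̃ − ∑_{p∣q̃} log p/p)`."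
Lemma 2.4: `C_{a,q₀} := (φ(a)/(a φ(q₀))) ∏_{p∤aq₀}(1 + 1/(p(p−1)))`,
`D_{a,q₀} := ∑_{p∣a} log p/p − ∑_{p∤aq₀} log p/(p²−p+1) + γ₀` (`γ₀` Euler–Mascheroni).
After Theorem 1.3: "Should [`(1−β)log x = o(1)`] happen, we would have that `η_{x,a} = χ̃(a) + o(1)`. If
moreover `a = 1` and `N ≤ q̃^{O(1)}`, then the main term of (1.11) would becomes asymptotically
`(1+o(1))μ̃_χ̃(a)`, and would not depend on `N` anymore. In this situation, the additional bias coming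
from the exceptional character would annihilate the `N`-dependance of the overall bias."

## Typing notes

* The objects `ψ*`, `M₁`, `M₁^Z`, `μ`, `C₀`, `η_{x,a}`, `C_{a,q₀}`, `D_{a,q₀}`, `μ̃` are defined below
  exactly as printed (`φ(a)/a` in `C_{a,q₀}` read as `φ(|a|)/|a|`, the paper's normalisation elsewhere
  and the only reading making the mean value of Lemma 2.4 positive; infinite products/sums over primes
  as `tprod`/`tsum` over `Nat.Primes`). `N` is real (the source allows `N ∈ ℝ_{≥1}`); `x` real.
* **Page's constant.** The case split of Theorem 1.3 is relative to the absolute `b` of Theorem 1.2,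
  which the source does not fix numerically; the fact below says `∃ b > 0, ∃ δ > 0, …` and renders
  "the `x`-exceptional character `χ̃ mod q̃`" by quantifying over ALL `(q̃, χ̃, β)` meeting the printed
  conditions (`q̃ ≤ e^{√log x}`, `χ̃` primitive real, `β` real with `β > 1 − b/log(QT) = 1 − b/(2√log x)`,
  `L(β, χ̃) = 0`) — for Page's `b` there is at most one such, so this is the printed statement; the
  three `O_{a,ε}` constants are merged into one `K = K(a, ε)`.
* **S6 vacuity audit.** The hypothesis of (1.10)/(1.11) is an `x`-exceptional zero:
  `1 − β < b/(2√log x) ≤ b/(2 log q̃)` since `q̃ ≤ e^{√log x}`, i.e. a zero of QUALITY `≥ 2/b` relative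
  to its own conductor, present only on the bounded range `log² q̃ ≤ log x < (b/(2(1−β)))²`. A bounded-
  quality hypothesis is NOT voided by the tree's (ineffective) Siegel theorem (`η ≪_ε q^ε` allows every
  fixed quality); (1.9) is hypothesis-free apart from "no `x`-exceptional character". Not S6.
  `DrappeauFiorilli2021.isExceptionalAt_of_isSiegelZero` (PROVED) records exactly when a Tao–Teräväinen
  Siegel zero of quality `η` triggers the illusory branch: for `log² q̃ ≤ log x < (bη log q̃/2)²`.

## Contents

* definitions `DrappeauFiorilli2021.psiStar`, `C0`, `mu`, `M1`, `normaliser`, `eta`, `M1Z`, `Cconst`,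
  `Dconst`, `biasSum`, `muTilde`, `IsExceptionalAt`;
* `drappeauFiorilli2021_theorem13` — NAMED FACT, Theorem 1.3 AS PRINTED (three clauses);
* PROVED: `DrappeauFiorilli2021.isExceptionalAt_of_isSiegelZero` (dictionary with
  `Literature.Barriers.Parity.IsSiegelZero`), `DrappeauFiorilli2021.eta_eq_of_apply_eq_one` (in a class
  with `χ̃(a) = 1`, `η_{x,a} = 1/(β x^{1−β})`, which tends to `1` as `(1−β) log x → 0`: the regime of the
  quoted "annihilation" remark).

Index only: Theorem 1.1 (the unconditional bias for `a = 1`, cited in the tree's route docstrings as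
[DrappeauFiorilli2020]); Lemma 2.2 (Bombieri–Vinogradov with the exceptional contribution removed);
Liu 2008 (second moment; not held).

LABEL: instrument / statement layer. WHAT THIS IS NOT: no claim that an exceptional character exists;
the unconditional content of the source is Theorem 1.1 (not typed here); nothing here bears on parity.

## References

* [DrappeauFiorilli2021] S. Drappeau, D. Fiorilli, *The first moment of primes in arithmetic
  progressions: beyond the Siegel–Walfisz range*, Trans. London Math. Soc. 8 (2021), no. 1, 174–185,
  doi:10.1112/tlm3.12030 = arXiv:2003.02201: §1 (1.1)–(1.11), Theorems 1.1–1.3; §2.3 Lemma 2.4.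
* [IwaniecKowalski2004] H. Iwaniec, E. Kowalski, *Analytic Number Theory*, AMS 2004 (Page's theorem as
  cited by the source, Theorem 1.2).
* [TaoTeravainen2021] T. Tao, J. Teräväinen, J. London Math. Soc. 106 (2022), Definition 1.4.
-/

noncomputable section

open Finset Real
open scoped ArithmeticFunction.vonMangoldt
open Literature.Barriers.Parity

namespace Literature.NumberTheory.LFunctions

namespace DrappeauFiorilli2021

/-- `ψ*(x; q, a) = ∑_{1 ≤ n ≤ x, n ≡ a (mod q), n ≠ a} Λ(n)` ("we have excluded the first term because it
has a significant contribution which is trivial to estimate"). [cite: DrappeauFiorilli2021, §1 (definition of ψ*)] -/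
def psiStar (x : ℝ) (q : ℕ) (a : ℤ) : ℝ :=
  ∑ n ∈ (Finset.Icc 1 ⌊x⌋₊).filter (fun n : ℕ => ((n : ℤ) : ZMod q) = (a : ZMod q) ∧ (n : ℤ) ≠ a), Λ n

/-- `C₀ = ½(log 2π + γ + ∑_p log p/(p(p−1)) + 1)`. [cite: DrappeauFiorilli2021, §1 (1.2)] -/
def C0 : ℝ :=
  (1 / 2) * (Real.log (2 * Real.pi) + Real.eulerMascheroniConstant
    + (∑' p : Nat.Primes, Real.log (p : ℕ) / (((p : ℕ) : ℝ) * (((p : ℕ) : ℝ) - 1))) + 1)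

/-- Fiorilli's bias `μ(a, N)`: `−½ log N − C₀` if `a = ±1`, `−½ log p` if `a = ±p^e`, `0` otherwise.
[cite: DrappeauFiorilli2021, §1 (1.3)] -/
def mu (a : ℤ) (N : ℝ) : ℝ :=
  if a.natAbs = 1 then -(1 / 2) * Real.log N - C0
  else if IsPrimePow a.natAbs then -(1 / 2) * Real.log (a.natAbs.minFac)
  else 0

/-- `M₁(x, N; a) = ∑_{q ≤ x/N, (q,a)=1} (ψ*(x; q, a) − x/φ(q))`. [cite: DrappeauFiorilli2021, §1 (definition of M₁)] -/
def M1 (x N : ℝ) (a : ℤ) : ℝ :=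
  ∑ q ∈ (Finset.Icc 1 ⌊x / N⌋₊).filter (fun q : ℕ => Int.gcd (q : ℤ) a = 1),
    (psiStar x q a - x / (Nat.totient q : ℝ))

/-- The normaliser `(φ(|a|)/|a|)·(x/N)` of (1.8)–(1.11). [cite: DrappeauFiorilli2021, §1 (1.8)] -/
def normaliser (x N : ℝ) (a : ℤ) : ℝ :=
  ((Nat.totient a.natAbs : ℝ) / (a.natAbs : ℝ)) * (x / N)

/-- `η_{x,a} = χ̃(a)/(β x^{1−β})` for the `x`-exceptional character `χ̃` and its zero `β` (real, as
`χ̃` is real). [cite: DrappeauFiorilli2021, §1 (1.6)] -/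
def eta {qt : ℕ} (χt : DirichletCharacter ℂ qt) (β x : ℝ) (a : ℤ) : ℝ :=
  (χt (a : ZMod qt)).re / (β * x ^ (1 - β))

/-- `M₁^Z(x, N; a) = ∑_{q ≤ x/N, (q,a)=1} (ψ*(x; q, a) − (1 − 1_{q̃∣q} η_{x,a}) x/φ(q))`.
[cite: DrappeauFiorilli2021, §1 (1.7)] -/
def M1Z (x N : ℝ) (a : ℤ) {qt : ℕ} (χt : DirichletCharacter ℂ qt) (β : ℝ) : ℝ :=
  ∑ q ∈ (Finset.Icc 1 ⌊x / N⌋₊).filter (fun q : ℕ => Int.gcd (q : ℤ) a = 1),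
    (psiStar x q a - (1 - (if qt ∣ q then eta χt β x a else 0)) * (x / (Nat.totient q : ℝ)))

/-- `C_{a,q₀} = (φ(|a|)/(|a| φ(q₀))) ∏_{p ∤ a q₀} (1 + 1/(p(p−1)))` (Fouvry's constant, Lemma 2.4).
[cite: DrappeauFiorilli2021, §2.3 Lemma 2.4 (definition of C_{a,q₀})] -/
def Cconst (a : ℤ) (q₀ : ℕ) : ℝ :=
  ((Nat.totient a.natAbs : ℝ) / ((a.natAbs : ℝ) * (Nat.totient q₀ : ℝ))) *
    ∏' p : Nat.Primes, (if (p : ℕ) ∣ a.natAbs * q₀ then (1 : ℝ)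
      else 1 + 1 / ((((p : ℕ) : ℝ)) * ((((p : ℕ) : ℝ)) - 1)))

/-- `D_{a,q₀} = ∑_{p ∣ a} log p/p − ∑_{p ∤ a q₀} log p/(p² − p + 1) + γ₀`.
[cite: DrappeauFiorilli2021, §2.3 Lemma 2.4 (definition of D_{a,q₀})] -/
def Dconst (a : ℤ) (q₀ : ℕ) : ℝ :=
  (∑ p ∈ a.natAbs.primeFactors, Real.log p / (p : ℝ))
    - (∑' p : Nat.Primes, (if (p : ℕ) ∣ a.natAbs * q₀ then (0 : ℝ)
        else Real.log (p : ℕ) / ((((p : ℕ) : ℝ)) ^ 2 - ((p : ℕ) : ℝ) + 1)))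
    + Real.eulerMascheroniConstant

/-- The sum `∑_{r ≤ N, (r,a)=1, q̃ ∣ r} (1 − (r/N)^β)/φ(r)` of (1.10). [cite: DrappeauFiorilli2021, §1 (1.10)] -/
def biasSum (N : ℝ) (a : ℤ) (qt : ℕ) (β : ℝ) : ℝ :=
  ∑ r ∈ (Finset.Icc 1 ⌊N⌋₊).filter (fun r : ℕ => Int.gcd (r : ℤ) a = 1 ∧ qt ∣ r),
    (1 - ((r : ℝ) / N) ^ β) / (Nat.totient r : ℝ)

/-- `μ̃_χ̃(a) = ½ 1_{a=±1} (log q̃ − ∑_{p ∣ q̃} log p/p)`. [cite: DrappeauFiorilli2021, §1 (after (1.11))] -/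
def muTilde (a : ℤ) (qt : ℕ) : ℝ :=
  if a.natAbs = 1 then (1 / 2) * (Real.log qt - ∑ p ∈ qt.primeFactors, Real.log p / (p : ℝ)) else 0

/-- «`χ̃ mod q̃` is `x`-exceptional (with zero `β`)» relative to Page's constant `b`: the printed
conditions of Theorem 1.2 with `Q = T = e^{√log x}` — `q̃ ≤ e^{√log x}`, `χ̃` primitive and real, `β` a
real zero of `L(s, χ̃)` with `β > 1 − b/log(QT) = 1 − b/(2√log x)` (and `|Im β| = 0 ≤ T`).
[cite: DrappeauFiorilli2021, §1 Theorem 1.2 and the definition after it] -/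
def IsExceptionalAt (b x : ℝ) (qt : ℕ) [NeZero qt] (χt : DirichletCharacter ℂ qt) (β : ℝ) : Prop :=
  (qt : ℝ) ≤ Real.exp (Real.sqrt (Real.log x)) ∧ χt.IsPrimitive ∧ χt.IsQuadratic ∧
    1 - b / (2 * Real.sqrt (Real.log x)) < β ∧ χt.LFunction (β : ℂ) = 0

end DrappeauFiorilli2021

open DrappeauFiorilli2021 in
/-- **Drappeau–Fiorilli 2021, Theorem 1.3** (NAMED FACT, AS PRINTED, the three clauses (1.9)–(1.11);
Page's absolute `b` and the "small enough positive absolute constant `δ`" existential, the `O_{a,ε}`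
constants merged into one `K(a, ε)`): for `a ≠ 0`, `ε > 0`, `x ≥ 2`, `2 ≤ N ≤ e^{δ√log x}`:
(1.9) no `x`-exceptional character ⇒ `M₁/((φ(|a|)/|a|) x/N) = μ(a,N) + O(N^{−171/448+ε})`;
(1.10) an `x`-exceptional `χ̃ mod q̃` with zero `β` ⇒ `M₁^Z/(…) = μ(a,N) + N η_{x,a}(∑_{r ≤ N,(r,a)=1,q̃∣r}
(1−(r/N)^β)/φ(r) − C_{a,q̃}{log(N/q̃) + D_{a,q̃} − 1/β}) + O(N^{−171/448+ε})`;
(1.11) if moreover `N ≥ q̃` ⇒ `M₁^Z/(…) = (1 − η_{x,a})μ(a,N) + η_{x,a} μ̃_χ̃(a) +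
O(N^ε (N/q̃)^{−171/448} + (log N)²(1−β)/x^{(1−β)/2})`. Not proved here (dispersion estimate of
[Drappeau 2017] with the exceptional character, divisor switching, Lemmas 2.2–2.7 of the source).
[cite: DrappeauFiorilli2021, §1 Theorem 1.3 with (1.3), (1.6), (1.7), Theorem 1.2 and §2.3 Lemma 2.4] -/
def drappeauFiorilli2021_theorem13 : Prop :=
  ∃ b : ℝ, 0 < b ∧ ∃ δ : ℝ, 0 < δ ∧ ∀ a : ℤ, a ≠ 0 → ∀ ε : ℝ, 0 < ε → ∃ K : ℝ,
    ∀ x N : ℝ, 2 ≤ x → 2 ≤ N → N ≤ Real.exp (δ * Real.sqrt (Real.log x)) →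
      -- (1.9): no `x`-exceptional character
      ((¬ ∃ (qt : ℕ) (_ : NeZero qt) (χt : DirichletCharacter ℂ qt) (β : ℝ),
          IsExceptionalAt b x qt χt β) →
        |M1 x N a / normaliser x N a - mu a N| ≤ K * N ^ (-(171 / 448 : ℝ) + ε)) ∧
      -- (1.10): the `x`-exceptional character exists
      (∀ (qt : ℕ) [NeZero qt] (χt : DirichletCharacter ℂ qt) (β : ℝ), IsExceptionalAt b x qt χt β →
        |M1Z x N a χt β / normaliser x N a
            - (mu a N + N * eta χt β x a *
                (biasSum N a qt β - Cconst a qt * (Real.log (N / qt) + Dconst a qt - 1 / β)))|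
          ≤ K * N ^ (-(171 / 448 : ℝ) + ε)) ∧
      -- (1.11): the `x`-exceptional character exists and `N ≥ q̃`
      (∀ (qt : ℕ) [NeZero qt] (χt : DirichletCharacter ℂ qt) (β : ℝ), IsExceptionalAt b x qt χt β →
        (qt : ℝ) ≤ N →
        |M1Z x N a χt β / normaliser x N a
            - ((1 - eta χt β x a) * mu a N + eta χt β x a * muTilde a qt)|
          ≤ K * (N ^ ε * (N / qt) ^ (-(171 / 448 : ℝ))
                + Real.log N ^ 2 * (1 - β) / x ^ ((1 - β) / 2)))

namespace DrappeauFiorilli2021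

/-- In a class with `χ̃(a) = 1` the distortion factor is `η_{x,a} = 1/(β x^{1−β})` (so `η_{x,a} → 1` as
`(1 − β) log x → 0`: the regime of the source's remark "the additional bias coming from the exceptional
character would annihilate the `N`-dependance of the overall bias"). [cite: DrappeauFiorilli2021, §1 (1.6) and the paragraph after Theorem 1.3] -/
theorem eta_eq_of_apply_eq_one {qt : ℕ} (χt : DirichletCharacter ℂ qt) {β x : ℝ} {a : ℤ}
    (ha : χt (a : ZMod qt) = 1) : eta χt β x a = 1 / (β * x ^ (1 - β)) := by
  simp [eta, ha]

/-- **When does a Siegel zero trigger the illusory branch of Theorem 1.3?** (PROVED dictionary.) A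
Tao–Teräväinen Siegel zero of quality `η` attached to `χ̃` mod `q̃ ≥ 3` (`χ̃` primitive quadratic,
`L(1 − 1/(η log q̃), χ̃) = 0`) makes `χ̃` `x`-exceptional (for Page's constant `b > 0`) at every `x` with
`log² q̃ ≤ log x < (b η log q̃ / 2)²`: the first inequality is `q̃ ≤ e^{√log x}`, the second is
`1/(η log q̃) < b/(2√log x)`. The range is non-empty iff `bη > 2`. [cite: DrappeauFiorilli2021, §1 Theorem 1.2 and the definition after it]
[cite: TaoTeravainen2021, Definition 1.4] -/
theorem isExceptionalAt_of_isSiegelZero {b : ℝ} (hb : 0 < b) {qt : ℕ} [NeZero qt] (hq : 3 ≤ qt)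
    {χt : DirichletCharacter ℂ qt} {η : ℝ} (hSZ : IsSiegelZero χt η) {x : ℝ}
    (hx1 : Real.log qt ^ 2 ≤ Real.log x) (hx2 : Real.log x < (b * η * Real.log qt / 2) ^ 2) :
    IsExceptionalAt b x qt χt (1 - 1 / (η * Real.log qt)) := by
  obtain ⟨hprim, hquad, h10, hzero⟩ := hSZ
  have hq3 : (3 : ℝ) ≤ qt := by exact_mod_cast hq
  have hq0 : (0 : ℝ) < qt := by linarith
  have hlogq : 0 < Real.log qt := Real.log_pos (by linarith)
  have hη : 0 < η := by linarith
  have hlogx0 : 0 ≤ Real.log x := le_trans (sq_nonneg _) hx1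
  refine ⟨?_, hprim, hquad, ?_, ?_⟩
  · -- `q̃ ≤ e^{√log x}` from `log q̃ ≤ √log x`
    have h1 : Real.log qt ≤ Real.sqrt (Real.log x) := by
      rw [← Real.sqrt_sq hlogq.le]
      exact Real.sqrt_le_sqrt hx1
    calc (qt : ℝ) = Real.exp (Real.log qt) := (Real.exp_log hq0).symm
      _ ≤ Real.exp (Real.sqrt (Real.log x)) := Real.exp_le_exp.mpr h1
  · -- `1 − b/(2√log x) < 1 − 1/(η log q̃)` iff `1/(η log q̃) < b/(2√log x)`
    have hs : Real.sqrt (Real.log x) < b * η * Real.log qt / 2 := by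
      have hpos : 0 ≤ b * η * Real.log qt / 2 := by positivity
      calc Real.sqrt (Real.log x) < Real.sqrt ((b * η * Real.log qt / 2) ^ 2) :=
            Real.sqrt_lt_sqrt hlogx0 hx2
        _ = b * η * Real.log qt / 2 := Real.sqrt_sq hpos
    have hsqrt0 : 0 < Real.sqrt (Real.log x) := by
      have : 0 < Real.log x := lt_of_lt_of_le (by positivity) hx1
      exact Real.sqrt_pos.mpr this
    have key : 1 / (η * Real.log qt) < b / (2 * Real.sqrt (Real.log x)) := by
      rw [div_lt_div_iff₀ (by positivity) (by positivity)]
      nlinarith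
    linarith
  · have hcast : (((1 - 1 / (η * Real.log qt) : ℝ)) : ℂ) = ((1 - 1 / (η * Real.log qt) : ℝ) : ℂ) := rfl
    exact hzero


/-! ### «There is at most one such character» (appended 2026-08-26): the uniqueness clause of the
source's Theorem 1.2 at `Q = T = e^{√log x}`, PROVED for some absolute `b > 0` from the tree's
Landau–Page theorems (`LandauPageRealZeros.lean`: Montgomery–Vaughan Theorem 11.3 Case 4 and
Theorem 11.7), justifying the `∀`-rendering of «the `x`-exceptional character» in
`drappeauFiorilli2021_theorem13`. -/

/-- `log q ≤ √log x` when `q ≤ e^{√log x}` (`q ≥ 1`). [cite: DrappeauFiorilli2021, §1 Theorem 1.2 and the definition after it] -/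
private theorem log_le_sqrt_of_le_exp {q : ℕ} [NeZero q] {x : ℝ}
    (hq : (q : ℝ) ≤ Real.exp (Real.sqrt (Real.log x))) : Real.log q ≤ Real.sqrt (Real.log x) := by
  have hq0 : (0 : ℝ) < q := by exact_mod_cast Nat.pos_of_ne_zero (NeZero.ne q)
  exact (Real.log_le_iff_le_exp hq0).mpr hq

/-- `√log x > 4/5` for `x ≥ 2` (`log 2 > 0.69 > 16/25`). [folklore] -/
private theorem half_lt_sqrt_log {x : ℝ} (hx : 2 ≤ x) : 4 / 5 < Real.sqrt (Real.log x) := by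
  have h2 : Real.log 2 ≤ Real.log x := Real.log_le_log (by norm_num) hx
  have hlog2 : (4 / 5) ^ 2 < Real.log 2 := by
    have := Real.log_two_gt_d9; norm_num at this ⊢; linarith
  have : (4 / 5 : ℝ) ^ 2 < Real.log x := lt_of_lt_of_le hlog2 h2
  calc (4 / 5 : ℝ) = Real.sqrt ((4 / 5) ^ 2) := by rw [Real.sqrt_sq (by norm_num)]
    _ < Real.sqrt (Real.log x) := Real.sqrt_lt_sqrt (by norm_num) this

/-- An `x`-exceptional triple has `0 < β < 1`, `χ̃ ≠ 1` and `χ̃² = 1`, provided `b ≤ 1` (for `x ≥ 2`: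
`b/(2√log x) < 5/8 < 1`, so `β > 0`; a real zero in `(0, 1]`… is `< 1` and the character is not principal,
since `ζ(σ) ≠ 0` on `[0, 1)` and no `L(s, χ)` vanishes on `Re s ≥ 1`). [cite: DrappeauFiorilli2021, §1 Theorem 1.2] -/
private theorem exceptional_basic {b x : ℝ} (hb : b ≤ 1) (hx : 2 ≤ x) {q : ℕ} [NeZero q]
    {χ : DirichletCharacter ℂ q} {β : ℝ} (h : IsExceptionalAt b x q χ β) :
    0 < β ∧ β < 1 ∧ χ ≠ 1 ∧ χ ^ 2 = 1 := by
  obtain ⟨hqx, hprim, hquad, hβ, hzero⟩ := h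
  have hs := half_lt_sqrt_log hx
  have hsq0 : 0 < Real.sqrt (Real.log x) := by linarith
  have hfrac : b / (2 * Real.sqrt (Real.log x)) < 1 := by
    rw [div_lt_one (by positivity)]; linarith
  have hβ0 : 0 < β := by linarith
  have hsq : χ ^ 2 = 1 := hquad.sq_eq_one
  -- `β < 1`: no zero on `Re s ≥ 1` (for `χ ≠ 1`), resp. none of `ζ` there
  have hβ1 : β < 1 := by
    by_contra hge
    rw [not_lt] at hge
    by_cases hχ : χ = 1
    · subst hχ
      -- `q = 1` (primitive principal character) and `L(s, 1 mod 1) = ζ`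
      have hq1 : q = 1 := by
        have hcond : (1 : DirichletCharacter ℂ q).conductor = q :=
          (DirichletCharacter.isPrimitive_def _).mp hprim
        rw [DirichletCharacter.conductor_one] at hcond
        exact hcond.symm
      subst hq1
      rw [DirichletCharacter.LFunction_modOne_eq] at hzero
      exact riemannZeta_ne_zero_of_one_le_re (s := (β : ℂ)) (by simpa using hge) hzero
    · exact DirichletCharacter.LFunction_ne_zero_of_one_le_re χ (Or.inl hχ) (by simpa using hge) hzero
  have hne : χ ≠ 1 := by
    intro hχ
    subst hχ
    have hq1 : q = 1 := by
      have hcond : (1 : DirichletCharacter ℂ q).conductor = q :=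
        (DirichletCharacter.isPrimitive_def _).mp hprim
      rw [DirichletCharacter.conductor_one] at hcond
      exact hcond.symm
    subst hq1
    rw [DirichletCharacter.LFunction_modOne_eq] at hzero
    exact riemannZeta_ofReal_ne_zero_of_pos_of_lt_one β hβ0 hβ1 hzero
  exact ⟨hβ0, hβ1, hne, hsq⟩

/-- **«There is at most one such character»** (the uniqueness clause of the source's Theorem 1.2 at
`Q = T = e^{√log x}`, PROVED for SOME absolute `b > 0`): with `b = min 1 (c/2)`, `c` the minimum of
the tree's three Landau–Page constants (two real zeros of one `L(s, χ)`: MV Theorem 11.3 Case 4;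
real zeros of two distinct real characters, same or different moduli: MV Theorem 11.7), for every
`x ≥ 2` any two `x`-exceptional triples `(q̃ᵢ, χ̃ᵢ, βᵢ)` coincide: same modulus, same character
(as functions on `ℤ`), same zero. Indeed `log q̃₁q̃₂ + log 4 ≤ 4√log x`, so two distinct
exceptional objects would give `min βᵢ ≤ 1 − c/(4√log x) ≤ 1 − b/(2√log x)`.
[cite: DrappeauFiorilli2021, §1 Theorem 1.2 ("There is at most one such character")]
[cite: MontgomeryVaughan2007, Theorem 11.3 (Case 4) and Theorem 11.7] -/
theorem exists_atMostOne_exceptional :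
    ∃ b : ℝ, 0 < b ∧ ∀ x : ℝ, 2 ≤ x →
      ∀ (q₁ : ℕ) [NeZero q₁] (χ₁ : DirichletCharacter ℂ q₁) (β₁ : ℝ)
        (q₂ : ℕ) [NeZero q₂] (χ₂ : DirichletCharacter ℂ q₂) (β₂ : ℝ),
        IsExceptionalAt b x q₁ χ₁ β₁ → IsExceptionalAt b x q₂ χ₂ β₂ →
          q₁ = q₂ ∧ (∀ n : ℤ, χ₁ (n : ZMod q₁) = χ₂ (n : ZMod q₂)) ∧ β₁ = β₂ := by
  obtain ⟨cA, hcA, HA⟩ := DirichletZFR.exists_min_realZeros_le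
  obtain ⟨cB, hcB, HB⟩ := DirichletZFR.exists_landau_prodChar_min_le
  obtain ⟨cC, hcC, HC⟩ := DirichletZFR.exists_landau_sameLevel_min_le
  set c : ℝ := min cA (min cB cC) with hcdef
  have hc0 : 0 < c := lt_min hcA (lt_min hcB hcC)
  have hcA' : c ≤ cA := min_le_left _ _
  have hcB' : c ≤ cB := le_trans (min_le_right _ _) (min_le_left _ _)
  have hcC' : c ≤ cC := le_trans (min_le_right _ _) (min_le_right _ _)
  refine ⟨min 1 (c / 2), lt_min one_pos (by linarith), fun x hx q₁ _ χ₁ β₁ q₂ _ χ₂ β₂ h₁ h₂ => ?_⟩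
  set b : ℝ := min 1 (c / 2) with hbdef
  have hb1 : b ≤ 1 := min_le_left _ _
  have hbc : b ≤ c / 2 := min_le_right _ _
  obtain ⟨hβ₁0, hβ₁1, hne₁, hsq₁⟩ := exceptional_basic hb1 hx h₁
  obtain ⟨hβ₂0, hβ₂1, hne₂, hsq₂⟩ := exceptional_basic hb1 hx h₂
  obtain ⟨hq₁x, hprim₁, hquad₁, hlow₁, hz₁⟩ := h₁
  obtain ⟨hq₂x, hprim₂, hquad₂, hlow₂, hz₂⟩ := h₂
  -- sizes: `S = √log x > 1/2`, `log qᵢ ≤ S`, `log 4 ≤ 2S`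
  set S : ℝ := Real.sqrt (Real.log x) with hSdef
  have hS : 4 / 5 < S := half_lt_sqrt_log hx
  have hS0 : 0 < S := by linarith
  have hlq₁ : Real.log q₁ ≤ S := log_le_sqrt_of_le_exp hq₁x
  have hlq₂ : Real.log q₂ ≤ S := log_le_sqrt_of_le_exp hq₂x
  have hlq₁0 : 0 ≤ Real.log q₁ := Real.log_natCast_nonneg q₁
  have hlq₂0 : 0 ≤ Real.log q₂ := Real.log_natCast_nonneg q₂
  have hlog4 : Real.log 4 ≤ 2 * S := by
    have h4 : Real.log 4 < 1.3863 := by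
      have := Real.log_two_lt_d9
      rw [show (4 : ℝ) = 2 ^ 2 by norm_num, Real.log_pow]; push_cast; linarith
    linarith
  have hlog4pos : 0 < Real.log 4 := Real.log_pos (by norm_num)
  -- the common contradiction: a Landau–Page bound `min β β' ≤ 1 − c'/(D + log 4)` with `c ≤ c'`,
  -- `D ≤ 2S`, is incompatible with `β, β' > 1 − b/(2S)`
  have key : ∀ {c' D β β' : ℝ}, c ≤ c' → 0 ≤ D → D ≤ 2 * S →
      1 - b / (2 * S) < β → 1 - b / (2 * S) < β' → ¬ (min β β' ≤ 1 - c' / (D + Real.log 4)) := by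
    intro c' D β β' hcc' hD0 hD hβ hβ' hmin
    have hmin' : 1 - b / (2 * S) < min β β' := lt_min hβ hβ'
    have hden : 0 < D + Real.log 4 := by linarith
    have h1 : c' / (D + Real.log 4) ≥ c / (4 * S) := by
      rw [ge_iff_le, div_le_div_iff₀ (by positivity) hden]
      nlinarith
    have h2 : b / (2 * S) ≤ c / (4 * S) := by
      rw [div_le_div_iff₀ (by positivity) (by positivity)]
      nlinarith
    linarith
  -- Case analysis on the moduli
  by_cases hq : q₁ = q₂
  · subst hq
    refine ⟨rfl, ?_, ?_⟩
    · -- same modulus: the characters coincide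
      by_cases hχ : χ₁ = χ₂
      · intro n; rw [hχ]
      · exfalso
        have := HC q₁ χ₁ χ₂ hne₁ hne₂ hsq₁ hsq₂ hχ β₁ β₂ hz₁ hz₂
        exact key hcC' hlq₁0 (by linarith) hlow₁ hlow₂ this
    · -- same modulus and character: the zeros coincide
      by_cases hχ : χ₁ = χ₂
      · subst hχ
        by_contra hβ
        have := HA q₁ χ₁ hne₁ β₁ β₂ hz₁ hz₂ hβ
        exact key hcA' hlq₁0 (by linarith) hlow₁ hlow₂ this
      · exfalso
        have := HC q₁ χ₁ χ₂ hne₁ hne₂ hsq₁ hsq₂ hχ β₁ β₂ hz₁ hz₂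
        exact key hcC' hlq₁0 (by linarith) hlow₁ hlow₂ this
  · exfalso
    have hψ := DirichletZFR.prodChar_ne_one_of_isPrimitive χ₁ hprim₁ χ₂ hprim₂ hsq₂ hq
    have := HB q₁ q₂ χ₁ χ₂ hne₁ hne₂ hsq₁ hsq₂ hψ β₁ β₂ hz₁ hz₂
    have hlog12 : Real.log ((q₁ : ℝ) * q₂) = Real.log q₁ + Real.log q₂ := by
      have h10 : (0 : ℝ) < q₁ := by exact_mod_cast Nat.pos_of_ne_zero (NeZero.ne q₁)
      have h20 : (0 : ℝ) < q₂ := by exact_mod_cast Nat.pos_of_ne_zero (NeZero.ne q₂)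
      exact Real.log_mul h10.ne' h20.ne'
    rw [hlog12] at this
    exact key hcB' (by linarith) (by linarith) hlow₁ hlow₂ this

end DrappeauFiorilli2021

end Literature.NumberTheory.LFunctions

end
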